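import Summits.Ventures.PackingBounds.Conjectures.DiploSimplexPetersenCross

/-!
# Table: the diplo-simplex is not Riesz-`s` optimal at the even exponents inside the `X_n` windows (`n = 6, 7, 8, 9`, `s ≤ 16`)

Framing: lottery ticket; floor = certified bounds/negative ranges. Venture `PackingBounds` (cell `pub-packcert`, seat `pub-packcert-energy`, gen 26).
Instances of the `DiploSimplexPetersenCross` pattern (`exists_petersenCross_riesz` + closed form `dipValue_of_eq` + `norm_num`), completing the even exponents
`s ≤ 16` inside the windows where `X_n = Petersen ⊕ β_{n-4}` beats `D_n` (`n = 6`: `s > 4.09`; `n = 7`: `(6.06, 40.34)`; `n = 8`: `(8.22, 25.68)`; `n = 9`: `(11.60, 17.48)`):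
here `(6,10)`, `(6,12)`, `(7,10)`, `(7,12)`, `(8,12)`, `(8,14)`, `(9,16)`; already in the tree: `(5,4)`, `(6,6)`, `(6,8)` (`DiploSimplexFive/Six`), `(7,8)`, `(8,10)`, `(9,12)`,
`(9,14)` (`DiploSimplexPetersenCross`). (General form: `DiploSimplexThresholdAttained.not_diploMinimises_of_petersenCross_lt`.)
-/

noncomputable section

namespace Summit.Ventures.PackingBounds.Conjectures

/-- `¬ DiploMinimises 6 10` (`X_6` below `D_6` at `s = 10`, closed form). -/
theorem not_diploMinimises_six_ten : ¬ DiploMinimises 6 10 := by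
  intro h
  obtain ⟨C, hc, h1, hE⟩ := exists_petersenCross_riesz 2 5 10 (by norm_num)
  have hge := h C hc h1
  rw [hE, dipValue_of_eq 6 (by norm_num) 5 10 (by norm_num)] at hge
  norm_num at hge

/-- `¬ DiploMinimises 6 12` (`X_6` below `D_6` at `s = 12`, closed form). -/
theorem not_diploMinimises_six_twelve : ¬ DiploMinimises 6 12 := by
  intro h
  obtain ⟨C, hc, h1, hE⟩ := exists_petersenCross_riesz 2 6 12 (by norm_num)
  have hge := h C hc h1
  rw [hE, dipValue_of_eq 6 (by norm_num) 6 12 (by norm_num)] at hge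
  norm_num at hge

/-- `¬ DiploMinimises 7 10` (`X_7` below `D_7` at `s = 10`, closed form). -/
theorem not_diploMinimises_seven_ten : ¬ DiploMinimises 7 10 := by
  intro h
  obtain ⟨C, hc, h1, hE⟩ := exists_petersenCross_riesz 3 5 10 (by norm_num)
  have hge := h C hc h1
  rw [hE, dipValue_of_eq 7 (by norm_num) 5 10 (by norm_num)] at hge
  norm_num at hge

/-- `¬ DiploMinimises 7 12` (`X_7` below `D_7` at `s = 12`, closed form). -/
theorem not_diploMinimises_seven_twelve : ¬ DiploMinimises 7 12 := by
  intro h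
  obtain ⟨C, hc, h1, hE⟩ := exists_petersenCross_riesz 3 6 12 (by norm_num)
  have hge := h C hc h1
  rw [hE, dipValue_of_eq 7 (by norm_num) 6 12 (by norm_num)] at hge
  norm_num at hge

/-- `¬ DiploMinimises 8 12` (`X_8` below `D_8` at `s = 12`, closed form). -/
theorem not_diploMinimises_eight_twelve : ¬ DiploMinimises 8 12 := by
  intro h
  obtain ⟨C, hc, h1, hE⟩ := exists_petersenCross_riesz 4 6 12 (by norm_num)
  have hge := h C hc h1
  rw [hE, dipValue_of_eq 8 (by norm_num) 6 12 (by norm_num)] at hge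
  norm_num at hge

/-- `¬ DiploMinimises 8 14` (`X_8` below `D_8` at `s = 14`, closed form). -/
theorem not_diploMinimises_eight_fourteen : ¬ DiploMinimises 8 14 := by
  intro h
  obtain ⟨C, hc, h1, hE⟩ := exists_petersenCross_riesz 4 7 14 (by norm_num)
  have hge := h C hc h1
  rw [hE, dipValue_of_eq 8 (by norm_num) 7 14 (by norm_num)] at hge
  norm_num at hge

/-- `¬ DiploMinimises 9 16` (`X_9` below `D_9` at `s = 16`, closed form). -/
theorem not_diploMinimises_nine_sixteen : ¬ DiploMinimises 9 16 := by
  intro h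
  obtain ⟨C, hc, h1, hE⟩ := exists_petersenCross_riesz 5 8 16 (by norm_num)
  have hge := h C hc h1
  rw [hE, dipValue_of_eq 9 (by norm_num) 8 16 (by norm_num)] at hge
  norm_num at hge

end Summit.Ventures.PackingBounds.Conjectures

end
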